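import Mathlib
import HarnessLib
import Summits.MatrixMultiplication.MatrixMultiplication.Theorems.OutsiderSandwichCoupling

/-!
# OutsiderSandwichCouplingSubrank — the attack leaf `CouplingIsMM` is implied by the summit, given full asymptotic subrank of the coupling tensor

Route `OutsiderSandwich`, decomposition node g16 (laser descent), second layer.

`Theorems/OutsiderSandwichCoupling.lean` proved the exact cut
`S ⟺ CouplingTangency ∧ CouplingMergeOptimal` and `CouplingIsMM ⟹ CouplingTangency`, where
`CouplingIsMM` (`F⟨2,2,2⟩³ ≤ F(C)` at every universal spectral point, i.e. `⟨8,8,8⟩ ≲ C`) is the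
ω-free attack leaf and `C = C₁ ⊠ C₂ ⊠ C₃` (`couplingTensor`, format `64³`, `512` ones) is the product
of the three coupled blocks of `cw₂ ⊗ cw₂`.

This file records why the leaf is NOT stronger than the summit.  The support of `C` is tight (it is a
sub-support of the tight support of `cw₂^{⊗6}`) with uniform marginals on `64` points in each
direction, so by Strassen's theorem on the asymptotic subrank of tight sets (V. Strassen, J. reine
angew. Math. 413 (1991); stated as Christandl–Vrana–Zuiddam, arXiv:1709.07851, Thm. 4.4 / Cor. 4.5)
`Q̃(C) = 64`, whence `F(C) ≥ 64` for every spectral point.  We do not prove Strassen's theorem here;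
exactly as for `Literature…XyzFreeDiagonalHypothesis`, its instance for `C` is typed as an explicit,
ω-free, operational hypothesis `CouplingDiagonal` (large free diagonals in Kronecker powers of `C`),
with spectral shadow `CouplingSubrankFull` (`64 ≤ F(C)`), and we prove:

* `couplingSubrankFull_of_diagonal : CouplingDiagonal → CouplingSubrankFull`;
* `couplingIsMM_of_summit : CouplingSubrankFull → S → CouplingIsMM`
  (under `ω = 2` every universal point has `F⟨2,2,2⟩ ≤ 4`, so `F⟨2,2,2⟩³ ≤ 64 ≤ F(C)`);
* `summit_iff_couplingIsMM : CouplingSubrankFull → (S ⟺ CouplingIsMM ∧ CouplingMergeOptimal)` — the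
  refined exact cut whose attacked piece is the pure asymptotic comparison `⟨8,8,8⟩ ≲ C₁ ⊠ C₂ ⊠ C₃`;
* `couplingIsMM_iff_couplingTangency : CouplingSubrankFull → (CouplingIsMM ⟺ CouplingTangency)`.

No `sorry`, no new axioms.  `CouplingDiagonal` / `CouplingSubrankFull` are HYPOTHESES of the theorems
below (never assumed elsewhere); proving `CouplingDiagonal` is a formalisation task (Coppersmith–Winograd
diagonal extraction on the tight support of `C`), known in print.
-/

noncomputable section

open scoped BigOperators Topology
open Filter
open Literature.Computability.AlgebraicComplexity
open Summit.MatrixMultiplication.MatrixMultiplication.Theorems.OutsiderSandwichLaserFloor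
open Summit.MatrixMultiplication.MatrixMultiplication.Theorems.OutsiderSandwichLaserFloorCut
open Summit.MatrixMultiplication.MatrixMultiplication.Theorems.OutsiderSandwichCoupling

namespace Summit.MatrixMultiplication.MatrixMultiplication.Theorems.OutsiderSandwichCouplingSubrank

variable {F : SpectralMap ℂ}

/-! ## 1. The two hypotheses -/

/-- **CouplingDiagonal** (operational, ω-free; Strassen 1991 for the tight support of `C`): along a
cofinal set of `N`, the Kronecker power `C^{⊠N}` restricts to a diagonal (unit tensor) of size
`r ≥ 64^N · 2^{-εN}` — i.e. the coupling tensor has full asymptotic subrank `Q̃(C) = 64`.  Source: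
V. Strassen, J. reine angew. Math. 413 (1991) (asymptotic subrank of tight sets = max over support
distributions of the minimum marginal entropy; Christandl–Vrana–Zuiddam, arXiv:1709.07851, Thm. 4.4),
applied to the uniform distribution on the `512`-point support of `C`, whose marginals are uniform on
`64` points.  A HYPOTHESIS here; to be proved in a separate file. -/
def CouplingDiagonal : Prop :=
  ∀ ε : ℝ, 0 < ε → ∀ N₀ : ℕ, ∃ N : ℕ, N₀ ≤ N ∧ ∃ r : ℕ,
    TensorRestrictsTo (kroneckerPow couplingTensor N) (unitTensor ℂ r) ∧
    (64 : ℝ) ^ N ≤ (r : ℝ) * (2 : ℝ) ^ (ε * N)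

/-- **CouplingSubrankFull** (spectral shadow of `Q̃(C) = 64`): every universal spectral point takes
the maximal value permitted by the format on the coupling tensor from below, `64 ≤ F(C)`. -/
def CouplingSubrankFull : Prop :=
  ∀ F : SpectralMap ℂ, IsUniversalSpectralPoint ℂ F → (64 : ℝ) ≤ F couplingTensor

/-! ## 2. Diagonals give the spectral floor -/

/-- **`CouplingDiagonal ⟹ CouplingSubrankFull`**: apply `F` to `⟨r⟩ ≤ C^{⊠N}`, take `N`-th roots
(`64 ≤ 2^ε F(C)`), and let `ε → 0⁺`. -/
theorem couplingSubrankFull_of_diagonal (hD : CouplingDiagonal) : CouplingSubrankFull := by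
  intro F hF
  have hk0 : 0 ≤ F couplingTensor := hF.nonneg _
  have key : ∀ ε : ℝ, 0 < ε → ε < 1 → (64 : ℝ) ≤ (2 : ℝ) ^ ε * F couplingTensor := by
    intro ε hε hε1
    obtain ⟨N, hN, r, hres, hr⟩ := hD ε hε 1
    have hN0 : N ≠ 0 := by omega
    have h := hF.mono _ _ hres
    simp only [hF.map_unitTensor, hF.map_kroneckerPow] at h
    -- `h : (r : ℝ) ≤ F(C)^N`
    have e2 : (2 : ℝ) ^ (ε * N) = ((2 : ℝ) ^ ε) ^ N := Real.rpow_mul_natCast (by norm_num) _ _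
    rw [e2] at hr
    have hpow : ((64 : ℝ)) ^ N ≤ ((2 : ℝ) ^ ε * F couplingTensor) ^ N := by
      calc (64 : ℝ) ^ N ≤ (r : ℝ) * ((2 : ℝ) ^ ε) ^ N := hr
        _ ≤ F couplingTensor ^ N * ((2 : ℝ) ^ ε) ^ N :=
            mul_le_mul_of_nonneg_right h (by positivity)
        _ = ((2 : ℝ) ^ ε * F couplingTensor) ^ N := by rw [mul_pow]; ring
    exact le_of_pow_le_pow_left₀ hN0 (by positivity) hpow
  have hlim : Tendsto (fun ε : ℝ => (2 : ℝ) ^ ε * F couplingTensor) (𝓝[>] 0)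
      (𝓝 ((2 : ℝ) ^ (0 : ℝ) * F couplingTensor)) := by
    have hc : ContinuousAt (fun x : ℝ => (2 : ℝ) ^ x) 0 := Real.continuousAt_const_rpow (by norm_num)
    have ht : Tendsto (fun x : ℝ => (2 : ℝ) ^ x) (𝓝[>] 0) (𝓝 ((2 : ℝ) ^ (0 : ℝ))) :=
      hc.tendsto.mono_left nhdsWithin_le_nhds
    exact ht.mul_const _
  rw [Real.rpow_zero, one_mul] at hlim
  refine ge_of_tendsto hlim ?_
  filter_upwards [Ioo_mem_nhdsGT (zero_lt_one' ℝ)] with ε hε using key ε hε.1 hε.2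

/-! ## 3. Under the summit every universal point has `F⟨2,2,2⟩ ≤ 4` -/

/-- `ω = 2 ⟹ F⟨2,2,2⟩ ≤ 4` at every universal spectral point (`τ_F ≤ ω`). -/
theorem map_matMulTensor_le_four_of_summit (hS : _root_.MatrixMultiplication)
    (hF : IsUniversalSpectralPoint ℂ F) : F (matMulTensor ℂ 2 2 2) ≤ 4 := by
  have hω : omega ℂ = 2 := (_root_.MatrixMultiplication_iff).1 hS
  have hle : Real.logb 2 (F (matMulTensor ℂ 2 2 2)) ≤ 2 := by
    have h := matExp_le_omega hF
    linarith
  have h0 : 0 < F (matMulTensor ℂ 2 2 2) :=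
    lt_of_lt_of_le one_pos (one_le_map_matMulTensor hF (by norm_num))
  have h := (Real.logb_le_iff_le_rpow one_lt_two h0).1 hle
  rw [Real.rpow_two] at h
  linarith

/-! ## 4. The leaf is implied by the summit; the refined exact cut -/

/-- **`S ⟹ CouplingIsMM`** given full subrank: `F⟨2,2,2⟩³ ≤ 4³ = 64 ≤ F(C)`.  So the ω-free leaf
`⟨8,8,8⟩ ≲ C` is NECESSARY for `ω = 2` (modulo Strassen's tight-subrank theorem), not merely
sufficient for the attacked piece. -/
theorem couplingIsMM_of_summit (hQ : CouplingSubrankFull) (hS : _root_.MatrixMultiplication) :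
    CouplingIsMM := by
  intro F hF
  have hg0 : 0 ≤ F (matMulTensor ℂ 2 2 2) := hF.nonneg _
  have h4 := map_matMulTensor_le_four_of_summit hS hF
  calc F (matMulTensor ℂ 2 2 2) ^ 3 ≤ (4 : ℝ) ^ 3 := by gcongr
    _ = 64 := by norm_num
    _ ≤ F couplingTensor := hQ F hF

/-- `CouplingDiagonal`-form of the previous theorem. -/
theorem couplingIsMM_of_summit_of_diagonal (hD : CouplingDiagonal) (hS : _root_.MatrixMultiplication) :
    CouplingIsMM :=
  couplingIsMM_of_summit (couplingSubrankFull_of_diagonal hD) hS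

/-- **The refined exact cut**: given full subrank of the coupling tensor,
`S ⟺ CouplingIsMM ∧ CouplingMergeOptimal` — the attacked piece is the pure asymptotic comparison
`⟨8,8,8⟩ ≲ C₁ ⊠ C₂ ⊠ C₃`, the residual is the merge-optimality of some ω-attaining point. -/
theorem summit_iff_couplingIsMM (hQ : CouplingSubrankFull) :
    _root_.MatrixMultiplication ↔ CouplingIsMM ∧ CouplingMergeOptimal :=
  ⟨fun h => ⟨couplingIsMM_of_summit hQ h, couplingMergeOptimal_of_summit h⟩,
    fun h => summit_of_coupling (couplingTangency_of_couplingIsMM h.1) h.2⟩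

/-- `CouplingDiagonal`-form of the refined cut. -/
theorem summit_iff_couplingIsMM_of_diagonal (hD : CouplingDiagonal) :
    _root_.MatrixMultiplication ↔ CouplingIsMM ∧ CouplingMergeOptimal :=
  summit_iff_couplingIsMM (couplingSubrankFull_of_diagonal hD)

/-- Given full subrank and the residual, the leaf and the attacked piece of g16 are equivalent:
`CouplingMergeOptimal ⟹ (CouplingIsMM ⟺ CouplingTangency)`. -/
theorem couplingIsMM_iff_couplingTangency (hQ : CouplingSubrankFull) (hR : CouplingMergeOptimal) :
    CouplingIsMM ↔ CouplingTangency :=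
  ⟨couplingTangency_of_couplingIsMM,
    fun hA => couplingIsMM_of_summit hQ (summit_of_coupling hA hR)⟩

end Summit.MatrixMultiplication.MatrixMultiplication.Theorems.OutsiderSandwichCouplingSubrank
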